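import Summits.Ventures.QEC.Census.BB.BB360Words
import Literature.InformationTheory.QuantumCodes.BivariateBicycleCode360
import HarnessLib

/-!
# `[[360,12,≤24]]` data II: the numerals of `Census/BB/BB360Words.lean` ARE the typed check matrices of `BB.bb360`

Kernel-checked IDENTITIES `rowMatrix 360 bb360HX = BB.bb360.HXFlat` and `rowMatrix 360 bb360HZ = BB.bb360.HZFlat` (entrywise
`decide +kernel`, 2 × 64 800 entries, ≈ 150 s of kernel time each on the farm), and the commutation of the row words read through
them. `BB.bb360` = `QC(x⁹+y+y², y³+x²⁵+x²⁶)` on `ℤ₃₀ × ℤ₆`, the `[[360,12,≤24]]` row of Bravyi–Cross–Gambetta–Maslov–Rall–Yoder,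
Nature 627 (2024), Extended Data Table 1 (`Literature/InformationTheory/QuantumCodes/BivariateBicycleCode360.lean`). Same layout as
type-02's `Census/BB/BB288Data.lean`. Consumers: `Census/BB/BB360Rank.lean` (RREF rank certificates, `k = 12`) and
`Census/BB/BB360Claim.lean` (`d ≤ 24`, the printed upper bound) — take
`D := CSSCode.ofMatrices (rowMatrix 360 bb360HX) (rowMatrix 360 bb360HZ) comm_bb360Flat` and transport with
`BB.Code.k_eq_of_flat / zWitness_of_flat rowMatrix_bb360HX rowMatrix_bb360HZ`.

HONEST FRAMING: two identities + their commutation; nothing here certifies `k` or the distance of `BB.bb360`.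
-/

namespace Summit.Ventures.QEC.Census

open Matrix Literature.InformationTheory.QuantumCodes

set_option maxRecDepth 100000 in
/-- The numeral rows `bb360HX` ARE the typed flat check matrix `H^X` of `BB.bb360` (entrywise `decide +kernel`, 180 × 360 entries). -/
theorem rowMatrix_bb360HX : rowMatrix 360 bb360HX = BB.bb360.HXFlat := by
  ext i j
  revert i j
  decide +kernel

set_option maxRecDepth 100000 in
/-- The numeral rows `bb360HZ` ARE the typed flat check matrix `H^Z` of `BB.bb360` (entrywise `decide +kernel`, 180 × 360 entries). -/
theorem rowMatrix_bb360HZ : rowMatrix 360 bb360HZ = BB.bb360.HZFlat := by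
  ext i j
  revert i j
  decide +kernel

/-- Commutation of the row words `H^X (H^Z)ᵀ = 0`, inherited from the typed code through the two identities
(`BB.Code.HXFlat_mul_HZFlat_transpose`). -/
theorem comm_bb360Flat : rowMatrix 360 bb360HX * (rowMatrix 360 bb360HZ)ᵀ = 0 := by
  rw [rowMatrix_bb360HX, rowMatrix_bb360HZ]
  exact BB.bb360.HXFlat_mul_HZFlat_transpose

end Summit.Ventures.QEC.Census
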